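import Summits.QuantumFields.YangMills.Theorems.OnsetCalibrationOnsetVanishes

/-!
# Crux K2 `SubOnsetCeilings` (stmt-QuantumFields-23313), line `dlr-collar-subonset`:
# the registered stub `stub_centredBoundaryLaw6` holds in the degenerate-volume corner `Λ₅ ≤ 0`

The registered stub (Cruxes/SubOnsetCeilings/Lines/dlr_collar_subonset.lean, skeleton sha 2bbb845c) quantifies over
every floor datum `(v, f, g, h, Λ₅)`, `Λ₅ : ℝ` unrestricted.  Its hypothesis LIVE(ε) asks for the two non-triviality
floors on EVERY torus `(ℤ/(2L+1))⁴` with `Λ₅ ≤ s·L`, `L : ℕ`.  When `Λ₅ ≤ 0` the one-site torus `L = 0` is admissible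
at every resolution `s`, and on that fixed torus the action-density covariances vanish as `β → ∞` (weak-coupling
freezing, the landed `tendsto_torusCov_dens` of U = `OnsetVanishes`), uniformly in `s` because the test-function
weights are bounded (`abs_Q2_le`).  Hence LIVE(ε) fails for every `ε > 0` and the stub's conclusion holds vacuously:
the whole content of the stub (and of K1/K2) sits at `Λ₅ > 0`.  This file records that corner as a kernel-checked
partial result (siege seat oc-p2; `--supports stmt-QuantumFields-23313`); it is the `Λ₅`-analogue of the `∃ ε₀`
vacuity audit (refuter W33, ATTACKS.md §D1) and uses only U's lemmas.

HONEST LABEL: a degenerate corner of one stub of one line; nothing here bears on the crux proper, the route's leaf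
R2a-IV (conditional on K1 ∧ K2) or the summit; the YM mass gap is NOT proved by anything here.
-/

set_option autoImplicit false

noncomputable section

open scoped SchwartzMap
open MeasureTheory Filter Topology
open Literature.MathematicalPhysics.QuantumFieldTheory Literature.MathematicalPhysics.QuantumLattice
open Literature.MathematicalPhysics.AQFT Literature.Probability.LatticeModels
open Summit.QuantumFields.YangMills.Cruxes.OSLegsFromFemtoAndGap.DlrCollarTransfer

namespace Summit.QuantumFields.YangMills.Theorems.OnsetCalibration

/-- **No floors at non-positive physical volume.**  If `Λ₅ ≤ 0` then for every `ε > 0` there is `β₁` such that for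
all `β ≥ β₁` NO resolution `s` carries the `Q2`-floor on all admissible tori: the one-site torus `L = 0` is admissible
(`Λ₅ ≤ s·0`) and its covariances freeze.  [folklore] -/
theorem no_floor_of_nonpos_volume {G : Type} [Group G] [TopologicalSpace G] [IsTopologicalGroup G]
    [CompactSpace G] [MeasurableSpace G] [BorelSpace G] (r : LatticeRep G)
    (v w : 𝓢(EuclideanSpace ℝ (Fin 4), ℝ)) {Λ₅ ε : ℝ} (hΛ : Λ₅ ≤ 0) (hε : 0 < ε) :
    ∃ β₁ : ℝ, ∀ β : ℝ, β₁ ≤ β → ∀ s : ℝ, ¬ (∀ L : ℕ, Λ₅ ≤ s * L → ε ≤ Q2 G r β L s v w) := by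
  obtain ⟨Mv, hMv0, hMv⟩ := exists_abs_schwartz_le v
  obtain ⟨Mw, -, hMw⟩ := exists_abs_schwartz_le w
  have hT : Tendsto (fun β : ℝ => Mv * Mw * ∑ x ∈ box 4 0, ∑ y ∈ box 4 0,
      |torusE G r β 0 (fun U => dens G r x U * dens G r y U) -
        torusE G r β 0 (dens G r x) * torusE G r β 0 (dens G r y)|) atTop (𝓝 0) := by
    have h := tendsto_finsetSum (box 4 0) fun x _ => tendsto_finsetSum (box 4 0) fun y _ =>
      (tendsto_torusCov_dens r 0 x y).abs
    simp only [abs_zero, Finset.sum_const_zero] at h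
    simpa using h.const_mul (Mv * Mw)
  obtain ⟨β₁, hβ₁⟩ := Filter.eventually_atTop.1 ((tendsto_order.1 hT).2 ε hε)
  refine ⟨β₁, fun β hβ s hfl => ?_⟩
  have h0 : Λ₅ ≤ s * ((0 : ℕ) : ℝ) := by simpa using hΛ
  have hfloor := hfl 0 h0
  have hQ := abs_Q2_le r β 0 s v w hMv0 hMv hMw
  have hlt := hβ₁ β hβ
  linarith [le_abs_self (Q2 G r β 0 s v w)]

/-- **The registered stub `stub_centredBoundaryLaw6` restricted to `Λ₅ ≤ 0`** (verbatim matrix of the stub under the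
extra hypothesis `Λ₅ ≤ 0`): it holds with `ε₀ = 1`, because LIVE(ε) is false for every `ε > 0` by
`no_floor_of_nonpos_volume` (the one-site torus never carries the `Q2`-floor at large `β`).  Partial result for the
siege on the stub (crux stmt-QuantumFields-23313); the stub's content is the case `Λ₅ > 0`.  [folklore] -/
theorem stub_centredBoundaryLaw6_of_nonpos_volume :
    ∀ (G : Type) [Group G] [TopologicalSpace G] [IsTopologicalGroup G] [CompactSpace G],
      IsCompactSimpleLieGroup G → Nonempty (G ≃ₜ* Matrix.specialUnitaryGroup (Fin 2) ℂ) →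
      letI : MeasurableSpace G := borel G
      haveI : BorelSpace G := ⟨rfl⟩
      ∀ (r : LatticeRep G) (v f g h : 𝓢(EuclideanSpace ℝ (Fin 4), ℝ)) (Λ₅ : ℝ), Λ₅ ≤ 0 →
        ∃ ε₀ : ℝ, 0 < ε₀ ∧ ∀ ε : ℝ, 0 < ε → ε ≤ ε₀ →
          (∃ β₅ : ℝ, ∀ β : ℝ, β₅ ≤ β → ∃ s : ℝ, 0 < s ∧ s ≤ 1 ∧
            (∀ L : ℕ, Λ₅ ≤ s * L → ε ≤ Q2 G r β L s (thetaTest 4 v) v) ∧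
            (∀ L : ℕ, Λ₅ ≤ s * L → ε ≤ |Q3 G r β L s f g h|)) →
          ∃ (C₁ ℓ₁ β₁ : ℝ), 0 < ℓ₁ ∧ 0 ≤ C₁ ∧ ∀ β : ℝ, β₁ ≤ β → ∀ s : ℝ, 0 < s → s ≤ 1 →
            (∀ s' : ℝ, 2 * s ≤ s' → s' ≤ 1 →
              ¬ ((∀ L : ℕ, Λ₅ ≤ s' * L → ε ≤ Q2 G r β L s' (thetaTest 4 v) v) ∧
                 (∀ L : ℕ, Λ₅ ≤ s' * L → ε ≤ |Q3 G r β L s' f g h|))) →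
            ∀ (q : Fin 4 × Fin 4) (x : Fin 4 → ℤ) (R : ℕ), q.1 < q.2 → 1 ≤ R →
              ((2 * R + 3 : ℕ) : ℝ) * s ≤ ℓ₁ →
                ∃ m : ℝ, ∀ η : LGConfig 4 G,
                  |kerE G r β (fun k => x k - (R + 1)) (2 * R + 3) η (plane G r q x) - m| ≤ C₁ / (R : ℝ) ^ 4 := by
  intro G _ _ _ _ _ _
  letI : MeasurableSpace G := borel G
  haveI : BorelSpace G := ⟨rfl⟩
  intro r v f g h Λ₅ hΛ
  refine ⟨1, one_pos, fun ε hε _ hlive => ?_⟩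
  exfalso
  obtain ⟨β₅, hβ₅⟩ := hlive
  obtain ⟨β₁, hβ₁⟩ := no_floor_of_nonpos_volume r (thetaTest 4 v) v hΛ hε
  obtain ⟨s, -, -, hQ2, -⟩ := hβ₅ (max β₅ β₁) (le_max_left _ _)
  exact hβ₁ (max β₅ β₁) (le_max_right _ _) s hQ2

end Summit.QuantumFields.YangMills.Theorems.OnsetCalibration

end
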